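import Literature.MathematicalPhysics.QuantumFieldTheory.Balaban1983to89.B4Green244
import Literature.MathematicalPhysics.QuantumFieldTheory.Balaban1983to89.B4Torus248Decay

/-!
# `Balaban1983to89.B4TorusGreen244` — the basic equation (2.44) ON THE TORUS: the finite dual-grid kernel `torusKernel248`
# of B4 (2.48) solves `(−Δ^ξ + m² + aQ_j^*Q_j) K_T(·,y) = Q_j^*δ^T_y` on the torus of `N_μ` unit blocks per direction

T. Bałaban, *Regularity and decay of lattice Green's functions*, Commun. Math. Phys. **89**, 571–597 (1983)
[Balaban1983RegularityDecay] (cell paper B4): p. 572 [PDF 2] (the torus; (1.1), (1.3)–(1.6)), p. 584 [PDF 14] (2.43)–(2.46),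
p. 585 [PDF 15] (2.47)–(2.48).  Renders `1983-cmp89-regularity-decay-p002/p014/p015-x2.png` read as images by this seat.

CITATION HEADER (lean-in-tree rule 2026-08-18).  This module is a SUPPLEMENT, not a quotation.  PRINTED: p. 572, verbatim:
*"Another common case is to consider operators on subsets of a torus T_η which we identify with a rectangular parallelepiped in
ηZ^d with periodic conditions."*; p. 572 (1.6), verbatim: *"Our fundamental Green's function is a kernel of the operator
G_k(Ω,A) = (−Δ^{η,N}_{A,Ω} + m² + aP_k(A))^{−1}, where m² ≥ 0 and a is a positive constant close to 1."* (`P_k = Q_k^*Q_k`, (1.5));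
p. 584, verbatim: *"We apply it to the basic equation (−Δ^ξ + m_j² + a_jQ_j^*Q_j)φ₀ = f. (2.44) Defining the propagator G_j,
φ₀ = G_jf, we get (2.45)"*, solved by (2.46) and, for `f = Q_j^*g`, by (2.47)–(2.48) p. 585 — ON THE INFINITE LATTICE `ξZ^d`
(Fourier transform (2.43)).  The paper does not write the torus version of (2.43)–(2.48); the later papers use the same operator
on a torus (B5, CMP 95, p. 25 l. 35–36 and p. 36 l. 20–23, quoted in the header of `B4Torus248Decay`).

WHAT THE CELL ALREADY HAS (imported, untouched): `B4Green244.green244` (b04-g4, p180019/p180138) — on the infinite fine lattice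
`ℤ^d` (ξ-units) the kernel `K(z,y) = latticeKernel (G n a m² (z mod n)) (⌊z/n⌋ − y)` of (2.48) satisfies
`(−Δ^ξ + m² + aQ^*Q)_z K(z,y) = 1_{B(y)}(z)`, through the SYMBOL IDENTITY `B4Green244.opD_Gfull`:
`D_z Gfull(z;p′) = e^{ip′·⌊z/n⌋}` for every `p′` in the closed zone `[−π,π]^d`; and `B4Torus248Decay.torusKernel248` (b04-g4,
p179304) — the FINITE-TORUS kernel `(Π_μ N_μ)⁻¹ Σ_{k ∈ Π_μ ℤ/N_μ} G_{n,a,m²,τ}(p′_k) e^{ip′_k·x⁰}`, `p′_{k,μ} = 2π rep(k_μ/N_μ) ∈ [−π,π)`,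
with its volume-uniform torus-metric decay `kernel248_torusKernel_decay_torusMetric` and its identification with the
periodisation of the infinite-volume kernel `torusKernel248_eq_periodise`.  What was NOT typed (B4Torus248Decay header, HONEST
SCOPE (ii)): that `torusKernel248` has anything to do with the OPERATOR `−Δ^ξ + m² + aQ^*Q` on the torus.

THIS FILE (journal node G-B4-02a-TORUSGREEN244-KERNEL of the cell `pub-balaban`) closes that: it is a FINITE computation —
the symbol identity at the `Π_μ N_μ` dual momenta `p′_k ∈ [−π,π)^{d+1} ⊂ [−π,π]^{d+1}`, linearity of the finite stencil `D`, and
character orthogonality on `Π_μ ℤ/N_μ` (`B4TorusKernel.MultiPeriod.sum_mFourier_grid`).  No analysis, no contour shift.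
* `dualMomentum N k = (2π rep(k_μ/N_μ))_μ ∈ BZ (d+1)` (`dualMomentum_mem_BZ`); `mFourier_gridPt`: the grid character
  `Π_μ e^{2πi k_μ x_μ/N_μ}` IS the plane wave `e^{i p′_k·x}` at the dual momentum (`x ∈ ℤ^{d+1}`);
* `KT n a m2 N z y := torusKernel248 n a m2 (z mod n) N (⌊z/n⌋ − y)` — the torus kernel read at a fine point `z ∈ ℤ^{d+1}`
  (ξ-units) and a unit point `y ∈ ℤ^{d+1}`; `KT_eq_sum`: `KT(z,y) = Σ_k (Π N)⁻¹ e^{−ip′_k·y} · Gfull(z; p′_k)`;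
* `opD_sum_mul`: the stencil `D = opD` of `B4Green244` is linear over finite sums;
* **`torusGreen244`** — for every `n ≥ 1`, `a > 0`, `m² ≥ 0`, every period vector with all `N_μ ≥ 1` and all `z, y ∈ ℤ^{d+1}`:
  `opD n a m2 (fun z' => KT n a m2 N z' y) z = if (∀ μ, N_μ ∣ ⌊z/n⌋_μ − y_μ) then 1 else 0`, i.e.
  `(−Δ^ξ + m² + aQ_j^*Q_j)_z K_T(z,y) = 1[⌊z/n⌋ ≡ y mod N] = (Q_j^*δ^{T}_y)(z)`: the (2.48) torus kernel solves the basic equation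
  (2.44) on the torus with `f = Q_j^*` of the unit-torus delta function at the class of `y`;
* `torusGreen244_apply` — operator form: for an `(N_μ)_μ`-periodic unit-lattice `g`,
  `D_z Σ_{y ∈ Π_μ[0,N_μ)} K_T(z,y) g(y) = g(⌊z/n⌋) = (Q^*g)(z)`: `K_T` is a right inverse of the torus operator on the range of `Q^*`;
* PERIODICITY (the objects live on the tori): `KT_translate_right` (`y ↦ y + (N_μ m_μ)_μ`), `coarse_translate` /
  `offset_translate` (`⌊(z + nNm)/n⌋ = ⌊z/n⌋ + Nm`, `(z + nNm) mod n = z mod n`), `KT_translate_left` (`z ↦ z + (nN_μ m_μ)_μ`),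
  `stp_translate` / **`opD_translate`**: the stencil `D` maps `(nN_μ)_μ`-periodic functions to `(nN_μ)_μ`-periodic functions —
  with the period a multiple of the block side `n` no block straddles the identification, so `opD` restricted to periodic
  functions IS the operator `−Δ^ξ_{T} + m² + aQ^*Q` of (1.6) (A = 0) on the fine torus `T_ξ = Π_μ ℤ/(nN_μ)` of p. 572;
  `torusGreen244_periodic`: the right side is periodic too (consistency).

DICTIONARY / HONEST SCOPE.  (i) As in `B4Green244`: ξ-units (`n = L^j = ξ⁻¹`, fine point `z`, block label `⌊z/n⌋`, `A = 0`,
`Q^*Q` = block mean, `(Q^*g)(z) = g(⌊z/n⌋)`), any integer `n ≥ 1`, real `a > 0`, `m² ≥ 0`; here dimension `d+1 ≥ 1` (the torus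
engine `MultiPeriod` is indexed by `Fin (d+1)`).  (ii) EXISTENCE HALF: the module proves that `K_T(·,y)` is A periodic solution of
(2.44) on the torus with `f = Q^*δ^T_y`; that it is THE solution (injectivity of `−Δ^ξ_T + m² + aQ^*Q` on the finite torus — the
finite-volume form of the positivity (2.27): `⟨φ,Dφ⟩ = ‖∇^ξφ‖² + m²‖φ‖² + a‖Qφ‖² > 0` for `φ ≠ 0` when `a > 0`) is NOT typed here.
(iii) The dual momenta are the representatives `2π rep(k_μ/N_μ) ∈ [−π,π)` (B5 (1.29)); the module never moves representatives —
it evaluates the CLOSED-zone identity `opD_Gfull` at points of the half-open zone.  (iv) B4 itself needs (2.35) on parallelepipeds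
with Neumann conditions (reflections (2.42), pv17 `B4Reflection242`), not on the torus; the torus case is the one consumed by
B5/B6.  NOT covered: uniqueness (ii), the `η`-rescaling, `A ≠ 0`.  Value = kernel certificate of a located by-reference step (the
torus Green identity behind `B4Torus248Decay`'s HONEST SCOPE (ii)), NOT summit progress.  Unit b2b-balaban-b04-g5 (paper sub-cell
B04 gen 5); staged byte-identically under `HOME/lean/BalabanYm4/`.
-/

namespace Literature.MathematicalPhysics.QuantumFieldTheory.Balaban1983to89.B4TorusGreen244

open Complex Finset UnitAddTorus
open Literature.MathematicalPhysics.QuantumFieldTheory.Balaban1983to89.B4Strip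
open Literature.MathematicalPhysics.QuantumFieldTheory.Balaban1983to89.B4ContourShift
open Literature.MathematicalPhysics.QuantumFieldTheory.Balaban1983to89.B4StripSums
open Literature.MathematicalPhysics.QuantumFieldTheory.Balaban1983to89.B4TorusKernel
open Literature.MathematicalPhysics.QuantumFieldTheory.Balaban1983to89.B4Torus248Decay
open Literature.MathematicalPhysics.QuantumFieldTheory.Balaban1983to89.B4Green244
open scoped Real

noncomputable section

variable {d : ℕ}

/-! ### §1 Dual momenta of the unit torus `Π_μ ℤ/N_μ` and their characters -/

/-- the dual-torus momentum `p′_k = (2π rep(k_μ/N_μ))_μ ∈ [−π,π)^{d+1}` of the grid point `k ∈ Π_μ ℤ/N_μ` (B5 (1.29): `p_μ = (π/L′_μ)n_μ`,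
`−L′_μ ≤ n_μ < L′_μ`). [cite: Balaban1983RegularityDecay, p.572 (torus) with Balaban1984PropagatorsI p.23 (1.29); dictionary] [folklore] -/
def dualMomentum (N : Fin (d + 1) → ℕ) (k : (i : Fin (d + 1)) → Fin (N i)) : Fin (d + 1) → ℝ :=
  fun i => 2 * π * rep (MultiPeriod.gridPt N k i)

/-- the dual momenta lie in the closed Brillouin zone `[−π,π]^{d+1}` (indeed in the half-open one). [folklore] -/
theorem dualMomentum_mem_BZ (N : Fin (d + 1) → ℕ) (k : (i : Fin (d + 1)) → Fin (N i)) :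
    dualMomentum N k ∈ BZ (d + 1) :=
  two_pi_mul_mem_BZ (s := fun i => rep (MultiPeriod.gridPt N k i)) ⟨fun _ => (rep_mem _).1, fun _ => (rep_mem _).2.le⟩

/-- THE GRID CHARACTER IS THE PLANE WAVE AT THE DUAL MOMENTUM: `Π_μ e^{2πi k_μ x_μ/N_μ} = e^{i p′_k·x}` for `x ∈ ℤ^{d+1}`
(`e^{2πi t x} = e^{2πi rep(t) x}` for integer `x`). [folklore] -/
theorem mFourier_gridPt (N : Fin (d + 1) → ℕ) (k : (i : Fin (d + 1)) → Fin (N i)) (x : Fin (d + 1) → ℤ) :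
    mFourier x (MultiPeriod.gridPt N k) = cexp (I * phaseC (ofRealVec (dualMomentum N k)) x) := by
  have ht : (fun i => (((fun i => rep (MultiPeriod.gridPt N k i)) i : ℝ) : UnitAddCircle)) = MultiPeriod.gridPt N k :=
    funext fun i => AddCircle.coe_equivIco
  have hs : ((2 * π) • fun i => rep (MultiPeriod.gridPt N k i)) = dualMomentum N k := by
    funext i
    simp only [Pi.smul_apply, smul_eq_mul, dualMomentum]
  calc mFourier x (MultiPeriod.gridPt N k)
      = mFourier x (fun i => (((fun i => rep (MultiPeriod.gridPt N k i)) i : ℝ) : UnitAddCircle)) := by rw [ht]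
    _ = cexp (I * phase ((2 * π) • fun i => rep (MultiPeriod.gridPt N k i)) x) := mFourier_coe_eq x _
    _ = cexp (I * phaseC (ofRealVec (dualMomentum N k)) x) := by rw [hs, phaseC_ofRealVec]

/-- the phase is additive: `p·(x − y) = p·x − p·y`. [folklore] -/
theorem phaseC_sub (P : Fin (d + 1) → ℂ) (x y : Fin (d + 1) → ℤ) : phaseC P (x - y) = phaseC P x - phaseC P y := by
  unfold phaseC
  simp only [Pi.sub_apply, Int.cast_sub, mul_sub, Finset.sum_sub_distrib]

/-! ### §2 The torus kernel at a fine point, in Green form -/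

/-- THE FINITE-TORUS KERNEL OF `G_jQ_j^*` READ AT A FINE POINT: `K_T(z,y) := torusKernel248 n a m² (z mod n) N (⌊z/n⌋ − y)`,
`z ∈ ℤ^{d+1}` a fine point (ξ-units), `y ∈ ℤ^{d+1}` a unit point; `(nN_μ)_μ`-periodic in `z` and `(N_μ)_μ`-periodic in `y`
(`KT_translate_left/right`), i.e. a kernel on `T_ξ × T₁`. [cite: Balaban1983RegularityDecay, (2.48) p.585 with p.572 (torus);
dictionary] [folklore] -/
def KT (n : ℕ) [NeZero n] (a m2 : ℝ) (N : Fin (d + 1) → ℕ) (z y : Fin (d + 1) → ℤ) : ℂ :=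
  torusKernel248 n a m2 (offset n z) N (coarse n z - y)

/-- `Gfull(z; p′) = e^{ip′·⌊z/n⌋} G(z mod n; p′)` (`B4Green244.Gfull_finePt` at `z = n⌊z/n⌋ + (z mod n)`).
[cite: Balaban1983RegularityDecay, (2.48) p.585] -/
theorem Gfull_eq_phase_mul_G (n : ℕ) [NeZero n] (a m2 : ℝ) (z : Fin (d + 1) → ℤ) (P : Fin (d + 1) → ℂ) :
    Gfull n a m2 z P = cexp (I * phaseC P (coarse n z)) * G n a m2 (offset n z) P := by
  have h := Gfull_finePt n a m2 (coarse n z) (offset n z) P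
  rwa [finePt_coarse_offset] at h

/-- `torusKernel248` written with `dualMomentum` (definitional). [folklore] -/
theorem torusKernel248_eq_dual (n : ℕ) [NeZero n] (a m2 : ℝ) (τ : Fin (d + 1) → Fin n) (N : Fin (d + 1) → ℕ)
    (x : Fin (d + 1) → ℤ) :
    torusKernel248 n a m2 τ N x = (∏ i, ((N i : ℕ) : ℂ))⁻¹ * ∑ k : (i : Fin (d + 1)) → Fin (N i),
      G n a m2 τ (ofRealVec (dualMomentum N k)) * mFourier x (MultiPeriod.gridPt N k) := rfl

/-- GREEN FORM OF THE TORUS KERNEL: `K_T(z,y) = Σ_{k ∈ Π_μ ℤ/N_μ} [(Π_μ N_μ)⁻¹ e^{−ip′_k·y}] · Gfull(z; p′_k)` — a finite linear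
combination, with `z`-independent coefficients, of the functions `z ↦ Gfull(z; p′_k)` to which the symbol identity applies.
[cite: Balaban1983RegularityDecay, (2.47)–(2.48) p.585; dictionary] [folklore] -/
theorem KT_eq_sum (n : ℕ) [NeZero n] (a m2 : ℝ) (N : Fin (d + 1) → ℕ) (z y : Fin (d + 1) → ℤ) :
    KT n a m2 N z y = ∑ k : (i : Fin (d + 1)) → Fin (N i),
      ((∏ i, ((N i : ℕ) : ℂ))⁻¹ * cexp (-(I * phaseC (ofRealVec (dualMomentum N k)) y)))
        * Gfull n a m2 z (ofRealVec (dualMomentum N k)) := by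
  unfold KT
  rw [torusKernel248_eq_dual, Finset.mul_sum]
  refine Finset.sum_congr rfl fun k _ => ?_
  rw [mFourier_gridPt, Gfull_eq_phase_mul_G, phaseC_sub, mul_sub, Complex.exp_sub, Complex.exp_neg, div_eq_mul_inv]
  ring

/-! ### §3 Linearity of the stencil `D = −Δ^ξ + m² + aQ^*Q` over finite sums -/

/-- `D (Σ_k c_k φ_k) = Σ_k c_k Dφ_k` for a finite family and constant coefficients (`D` is the finite stencil
`B4Green244.opD_eq_stencil`). [folklore] -/
theorem opD_sum_mul {ι : Type*} (s : Finset ι) (n : ℕ) (a m2 : ℝ) (c : ι → ℂ) (φ : ι → (Fin d → ℤ) → ℂ)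
    (z : Fin d → ℤ) :
    opD n a m2 (fun z' => ∑ k ∈ s, c k * φ k z') z = ∑ k ∈ s, c k * opD n a m2 (φ k) z := by
  simp only [opD_eq_stencil, Finset.mul_sum]
  rw [Finset.sum_comm]
  exact Finset.sum_congr rfl fun k _ => Finset.sum_congr rfl fun i _ => by ring

/-! ### §4 The basic equation (2.44) on the torus -/

/-- **THE BASIC EQUATION (2.44) ON THE TORUS.**  For every `n = L^j ≥ 1`, `a > 0`, `m² ≥ 0`, every period vector `N` with all
`N_μ ≥ 1`, every fine point `z ∈ ℤ^{d+1}` (ξ-units) and unit point `y ∈ ℤ^{d+1}`: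
`(−Δ^ξ + m² + aQ_j^*Q_j)_z K_T(z,y) = 1[⌊z/n⌋ ≡ y mod (N_μ)_μ]` — the right side is `(Q_j^*δ^T_y)(z)`, the block-constant
extension of the delta function of the unit torus `Π_μ ℤ/N_μ` at the class of `y`.  PROOF = the symbol identity
`B4Green244.opD_Gfull` at each dual momentum `p′_k ∈ [−π,π]^{d+1}`, linearity `opD_sum_mul`, and character orthogonality
`MultiPeriod.sum_mFourier_grid`: `(ΠN)⁻¹ Σ_k e^{ip′_k·(⌊z/n⌋ − y)} = 1[N ∣ ⌊z/n⌋ − y]`.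
[cite: Balaban1983RegularityDecay, (2.44)–(2.48) p.584–585 with p.572 (torus, (1.6)); proof supplied by the audit — the torus
version is not printed] -/
theorem torusGreen244 (n : ℕ) [NeZero n] (hn : 1 ≤ n) (a m2 : ℝ) (ha : 0 < a) (hm : 0 ≤ m2)
    {N : Fin (d + 1) → ℕ} (hN : ∀ i, 1 ≤ N i) (z y : Fin (d + 1) → ℤ) :
    opD n a m2 (fun z' => KT n a m2 N z' y) z = if ∀ i, (N i : ℤ) ∣ coarse n z i - y i then 1 else 0 := by
  have hN0 : (∏ i, ((N i : ℕ) : ℂ)) ≠ 0 :=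
    Finset.prod_ne_zero_iff.mpr fun i _ => by
      have := hN i
      exact_mod_cast (show N i ≠ 0 by omega)
  have step : ∀ k : (i : Fin (d + 1)) → Fin (N i),
      ((∏ i, ((N i : ℕ) : ℂ))⁻¹ * cexp (-(I * phaseC (ofRealVec (dualMomentum N k)) y)))
        * opD n a m2 (fun z' => Gfull n a m2 z' (ofRealVec (dualMomentum N k))) z
      = (∏ i, ((N i : ℕ) : ℂ))⁻¹ * mFourier (coarse n z - y) (MultiPeriod.gridPt N k) := by
    intro k
    rw [opD_Gfull n hn a m2 ha hm z (dualMomentum N k) (dualMomentum_mem_BZ N k), mFourier_gridPt, phaseC_sub,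
      mul_sub, Complex.exp_sub, Complex.exp_neg, div_eq_mul_inv]
    ring
  simp_rw [KT_eq_sum]
  rw [opD_sum_mul]
  simp_rw [step]
  rw [← Finset.mul_sum, MultiPeriod.sum_mFourier_grid hN]
  simp only [Pi.sub_apply]
  split_ifs with h
  · exact inv_mul_cancel₀ hN0
  · exact mul_zero _

/-! ### §5 Periodicity: the kernel lives on `T_ξ × T₁`, the stencil `D` on `(nN_μ)_μ`-periodic functions is the torus operator -/

/-- `N_μ`-periodicity in the unit point: `K_T(z, y + (N_μ m_μ)_μ) = K_T(z,y)`. [folklore] -/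
theorem KT_translate_right (n : ℕ) [NeZero n] (a m2 : ℝ) {N : Fin (d + 1) → ℕ} (hN : ∀ i, 1 ≤ N i)
    (z y m : Fin (d + 1) → ℤ) : KT n a m2 N z (MultiPeriod.translate N y m) = KT n a m2 N z y := by
  unfold KT
  have h : coarse n z - MultiPeriod.translate N y m = MultiPeriod.translate N (coarse n z - y) (-m) := by
    funext i
    simp only [Pi.sub_apply, MultiPeriod.translate_apply, Pi.neg_apply]
    ring
  rw [h, torusKernel248_translate n a m2 (offset n z) hN]

/-- block labels of translates by the fine period: `⌊(z + nNm)/n⌋ = ⌊z/n⌋ + Nm`. [folklore] -/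
theorem coarse_translate (n : ℕ) [NeZero n] (N : Fin (d + 1) → ℕ) (z m : Fin (d + 1) → ℤ) :
    coarse n (MultiPeriod.translate (fun i => n * N i) z m) = MultiPeriod.translate N (coarse n z) m := by
  funext i
  simp only [coarse, MultiPeriod.translate_apply, Nat.cast_mul]
  rw [mul_assoc, Int.add_mul_ediv_left _ _ (by exact_mod_cast NeZero.ne n)]

/-- offsets of translates by the fine period: `(z + nNm) mod n = z mod n`. [folklore] -/
theorem offset_translate (n : ℕ) [NeZero n] (N : Fin (d + 1) → ℕ) (z m : Fin (d + 1) → ℤ) :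
    offset n (MultiPeriod.translate (fun i => n * N i) z m) = offset n z := by
  funext i
  apply Fin.ext
  simp only [offset, MultiPeriod.translate_apply, Nat.cast_mul]
  rw [mul_assoc, Int.add_mul_emod_self_left]

/-- `(nN_μ)_μ`-periodicity in the fine point: `K_T(z + (nN_μ m_μ)_μ, y) = K_T(z,y)` — `K_T(·,y)` is a function on the fine torus
`T_ξ = Π_μ ℤ/(nN_μ)` (`nN_μ` fine points = `N_μ` blocks per direction). [folklore] -/
theorem KT_translate_left (n : ℕ) [NeZero n] (a m2 : ℝ) {N : Fin (d + 1) → ℕ} (hN : ∀ i, 1 ≤ N i)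
    (z y m : Fin (d + 1) → ℤ) : KT n a m2 N (MultiPeriod.translate (fun i => n * N i) z m) y = KT n a m2 N z y := by
  unfold KT
  rw [coarse_translate, offset_translate]
  have h : MultiPeriod.translate N (coarse n z) m - y = MultiPeriod.translate N (coarse n z - y) m := by
    funext i
    simp only [Pi.sub_apply, MultiPeriod.translate_apply]
    ring
  rw [h, torusKernel248_translate n a m2 (offset n z) hN]

/-- the stencil points of `D` at a translate are the translates of the stencil points (neighbours trivially; block points because
the period `(nN_μ)_μ` is a multiple of the block side `n`, so no block straddles the identification). [folklore] -/
theorem stp_translate (n : ℕ) [NeZero n] (N : Fin (d + 1) → ℕ) (z m : Fin (d + 1) → ℤ) (i : Idx (d + 1) n) :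
    stp n (MultiPeriod.translate (fun i => n * N i) z m) i = MultiPeriod.translate (fun i => n * N i) (stp n z i) m := by
  rcases i with _ | μ | μ | j
  · rfl
  · funext ν
    simp only [stp, MultiPeriod.translate_apply, Pi.add_apply]
    ring
  · funext ν
    simp only [stp, MultiPeriod.translate_apply, Pi.sub_apply]
    ring
  · show finePt n (coarse n (MultiPeriod.translate (fun i => n * N i) z m)) j
      = MultiPeriod.translate (fun i => n * N i) (finePt n (coarse n z) j) m
    rw [coarse_translate]
    funext ν
    simp only [finePt, MultiPeriod.translate_apply, Nat.cast_mul]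
    ring

/-- **`D` IS THE TORUS OPERATOR ON PERIODIC FUNCTIONS**: if `φ` is `(nN_μ)_μ`-periodic then so is `Dφ = (−Δ^ξ + m² + aQ^*Q)φ`
(computed by the infinite-lattice stencil `B4Green244.opD`), i.e. `opD` restricted to `(nN_μ)_μ`-periodic functions is the
operator of (1.6) (`A = 0`) on the fine torus `T_ξ` of p. 572. [cite: Balaban1983RegularityDecay, p.572 (torus, (1.3)–(1.6));
dictionary] [folklore] -/
theorem opD_translate (n : ℕ) [NeZero n] (a m2 : ℝ) (N : Fin (d + 1) → ℕ) (φ : (Fin (d + 1) → ℤ) → ℂ)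
    (hφ : ∀ z m, φ (MultiPeriod.translate (fun i => n * N i) z m) = φ z) (z m : Fin (d + 1) → ℤ) :
    opD n a m2 φ (MultiPeriod.translate (fun i => n * N i) z m) = opD n a m2 φ z := by
  rw [opD_eq_stencil, opD_eq_stencil]
  exact Finset.sum_congr rfl fun i _ => by rw [stp_translate, hφ]

/-- consistency: the right side `1[⌊z/n⌋ ≡ y mod N]` of `torusGreen244` is `(nN_μ)_μ`-periodic in `z` as well. [folklore] -/
theorem torusGreen244_periodic (n : ℕ) [NeZero n] (N : Fin (d + 1) → ℕ) (z y m : Fin (d + 1) → ℤ) :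
    (∀ i, (N i : ℤ) ∣ coarse n (MultiPeriod.translate (fun i => n * N i) z m) i - y i)
      ↔ ∀ i, (N i : ℤ) ∣ coarse n z i - y i := by
  rw [coarse_translate]
  refine forall_congr' fun i => ?_
  rw [MultiPeriod.translate_apply, show coarse n z i + (N i : ℤ) * m i - y i = coarse n z i - y i + N i * m i by ring]
  exact dvd_add_left (dvd_mul_right _ _)

/-- **THE TORUS GREEN IDENTITY, OPERATOR FORM.**  For an `(N_μ)_μ`-periodic unit-lattice function `g` put
`(K_T g)(z) := Σ_{y ∈ Π_μ [0,N_μ)} K_T(z,y) g(y)`; then `D (K_T g) = Q^*g`, i.e. `(−Δ^ξ + m² + aQ^*Q)_z Σ_y K_T(z,y)g(y) = g(⌊z/n⌋)`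
— `K_T` is a right inverse of the torus operator on the range of `Q^*` (`= G_jQ_j^*` on the torus, granted injectivity of `D`,
which is not typed here). [cite: Balaban1983RegularityDecay, (2.44) p.584, (1.6) p.572; proof supplied by the audit] -/
theorem torusGreen244_apply (n : ℕ) [NeZero n] (hn : 1 ≤ n) (a m2 : ℝ) (ha : 0 < a) (hm : 0 ≤ m2)
    {N : Fin (d + 1) → ℕ} (hN : ∀ i, 1 ≤ N i) (g : (Fin (d + 1) → ℤ) → ℂ)
    (hg : ∀ y m, g (MultiPeriod.translate N y m) = g y) (z : Fin (d + 1) → ℤ) :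
    opD n a m2 (fun z' => ∑ y ∈ Fintype.piFinset (fun i => Finset.Ico (0 : ℤ) (N i)), g y * KT n a m2 N z' y) z
      = g (coarse n z) := by
  classical
  rw [opD_sum_mul]
  simp_rw [torusGreen244 n hn a m2 ha hm hN]
  have hNpos : ∀ i, (0 : ℤ) < N i := fun i => by have := hN i; omega
  -- the unique representative `r` of the class of `⌊z/n⌋` in the box `Π_μ [0, N_μ)`
  obtain ⟨r, hr⟩ : ∃ r : Fin (d + 1) → ℤ, ∀ i, r i = coarse n z i % N i := ⟨_, fun i => rfl⟩
  have hr0 : ∀ i, 0 ≤ r i := fun i => by rw [hr]; exact Int.emod_nonneg _ (hNpos i).ne'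
  have hr1 : ∀ i, r i < N i := fun i => by rw [hr]; exact Int.emod_lt_of_pos _ (hNpos i)
  have hr_mem : r ∈ Fintype.piFinset (fun i => Finset.Ico (0 : ℤ) (N i)) :=
    Fintype.mem_piFinset.mpr fun i => Finset.mem_Ico.mpr ⟨hr0 i, hr1 i⟩
  have hr_dvd : ∀ i, (N i : ℤ) ∣ coarse n z i - r i := fun i => Int.dvd_self_sub_of_emod_eq (hr i).symm
  have huniq : ∀ y ∈ Fintype.piFinset (fun i => Finset.Ico (0 : ℤ) (N i)),
      (∀ i, (N i : ℤ) ∣ coarse n z i - y i) → y = r := by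
    intro y hy hdy
    funext i
    have hyi := Finset.mem_Ico.mp (Fintype.mem_piFinset.mp hy i)
    have h1 : (N i : ℤ) ∣ y i - r i := by
      have := dvd_sub (hr_dvd i) (hdy i)
      rwa [sub_sub_sub_cancel_left] at this
    obtain ⟨c, hc⟩ := h1
    have hc1 : c < 1 := by
      by_contra hcon
      have hcon : 1 ≤ c := not_lt.mp hcon
      have : (N i : ℤ) * 1 ≤ N i * c := mul_le_mul_of_nonneg_left hcon (hNpos i).le
      linarith [hyi.1, hyi.2, hr0 i, hr1 i]
    have hc2 : -1 < c := by
      by_contra hcon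
      have hcon : c ≤ -1 := not_lt.mp hcon
      have : (N i : ℤ) * c ≤ N i * (-1) := mul_le_mul_of_nonneg_left hcon (hNpos i).le
      linarith [hyi.1, hyi.2, hr0 i, hr1 i]
    have hc0 : c = 0 := by omega
    rw [hc0, mul_zero, sub_eq_zero] at hc
    exact hc
  rw [Finset.sum_eq_single_of_mem _ hr_mem]
  · rw [if_pos hr_dvd, mul_one]
    -- `g r = g ⌊z/n⌋` by periodicity: `⌊z/n⌋ = r + N · (⌊z/n⌋ / N)`
    have e : coarse n z = MultiPeriod.translate N r (fun i => coarse n z i / N i) := by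
      funext i
      rw [MultiPeriod.translate_apply, hr]
      linarith [Int.mul_ediv_add_emod (coarse n z i) (N i)]
    rw [e, hg]
  · intro y hy hne
    rw [if_neg (fun h => hne (huniq y hy h)), mul_zero]

end

end Literature.MathematicalPhysics.QuantumFieldTheory.Balaban1983to89.B4TorusGreen244
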